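import Literature.NumberTheory.LFunctions.BeurlingClosureLpHolder
import HarnessLib

/-!
# Operator axis (NB-NEG V40): sections of Alcántara-Bode's injectivity criterion —
# cell `rh-split`, raw forms, ZERO defs; typed by rh-split-nb-neg g15

Annihilator / operator side of the Nyman–Beurling criterion.  The tree proves
`AlcantaraBode1993_criterion_holds : RH ↔ (A injective on L²(0,1))` for
`(Af)(θ) = ∫₀¹ f(x){θ/x} dx` (`alcantaraBodeOp`).  A splitting of the injectivity conjunct along
a SUBSPACE axis reads `FIN_V ∧ TAIL_V`: `FIN_V` = "A is injective (or uniformly bounded below) on an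
approximation subspace V", `TAIL_V` = "A is injective on a closed subspace of finite codimension"
(a hyperplane `{f : ∫₀¹ f·w = 0}` in codimension one).  This file (§1–§2) and its sequel
`NbOperatorCount.lean` (§3–§4) decide the shape:

* §1 (soft side, zero-free).  `‖(Af)(θ)‖ ≤ ∫₀¹‖f‖` (`norm_alcantaraBodeOp_le`); for the indicator
  `u_h = 𝟙_(0,h)`, `‖A u_h‖₂ ≤ h` while `‖u_h‖₂ = √h` (`eLpNorm_alcantaraBodeOp_indicator_le`,
  `eLpNorm_indicator_Ioo`), so `A` is NOT bounded below on `L²(0,1)`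
  (`alcantaraBodeOp_not_coercive`).  Every COERCIVE conjunct — "injectivity parameters bounded
  below uniformly in the mesh", the load-bearing hypothesis of a finite-section injectivity
  criterion — is refuted RH-free and zero-free, by a witness lying in every step-function space of
  mesh `h`.
* §2 (kernel pairs).  A zero `s` of `ζ` with `Re s > 0` puts
  `m_s(x) = (s-1)x^{s-1} - (s̄-1)x^{s̄-1}` (in `L¹(0,1)`; in `L²(0,1)` iff `Re s > 1/2`) in `ker A`
  (`alcantaraBodeOp_kernelPair`), with moments
  `∫₀¹ m_s(x) x^k dx = (s-1)/(s+k) - (s̄-1)/(s̄+k) = (k+1)(s-s̄)/((s+k)(s̄+k))`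
  (`integral_kernelPair_mul_pow`, `kernelPair_moment_eq`), so `m_s ≠ 0` (`kernelPair_not_ae_zero`).
* §2b (EXPONENT axis, RH-free).  By Hardy's theorem (tree: `hardy_infinite_zeros_on_critical_line_holds`)
  a critical-line zero `s = 1/2 + it` exists, and its kernel pair lies in `L^q(0,1)` for every
  `q < 2` (`memLp_cpow_Ioo_of_lt`): the `L^q`-extension of `A` (Alcántara-Bode: "`A` also makes sense
  on `L¹`") is NOT injective for any `0 < q < 2`, unconditionally (`alcantaraBodeOp_not_injective_Lq`)
  — the operator-side phrasing of the failure of Beurling's closure criterion in `L^p`, `p > 2`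
  (tree: `Beurling1955_closure_iff_of_two_le`).  Injectivity conjuncts below the exponent `2` are
  refuted RH-free; at `q = 2` the conjunct is RH; above `2` it is the abscissa `QRH(1 - 1/q)`.
* §3 (RH-free COUNT theorem).  If `A` is injective on ONE hyperplane `{f ∈ L² : ∫₀¹ f·w = 0}`
  (`w ∈ L²(0,1)`), then the zeros of `ζ` in `Re s > 1/2` form AT MOST ONE conjugate pair
  (`zero_eq_or_eq_conj_of_injOn_hyperplane`): two kernel pairs meeting one hyperplane are linearly
  dependent, and the three moments `k = 0, 1, 2` of a dependence force
  `s₂ s̄₂ = s₁ s̄₁`, `s₂ + s̄₂ = s₁ + s̄₁`, i.e. `(s₂ - s₁)(s₂ - s̄₁) = 0`.  So the codimension-one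
  TAIL conjunct UNDERSHOOTS RH by exactly "one exceptional pair"; the complementary conjunct
  "no exceptional pair" is `QuasiRiemannHypothesis (1/2)`, i.e. RH itself
  (`quasiRiemannHypothesis_one_half_iff_holds`) — a COUNT partition with an idle finite side
  (`rh_of_hyperplane_split`).
* §4 (RH side).  Under RH every hyperplane TAIL holds (`injOn_hyperplane_of_rh`), so the TAIL is
  RH-implied and has no lens-(iii) probe.

Every statement spells `_root_.RiemannHypothesis`.  No definitions.
-/

set_option linter.dupNamespace false

open MeasureTheory Set Complex Filter Topology
open scoped ENNReal
open Literature.NumberTheory.LFunctions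

namespace Summit.RiemannHypothesis.RiemannHypothesis.Theorems.Splittings.NbOperator

/-! ## §1  Soft side: `A : L¹ → L^∞` is bounded, hence `A` is not bounded below on `L²(0,1)` -/

/-- `‖(Af)(θ)‖ ≤ ∫₀¹ ‖f‖` for `f` integrable on `(0,1)` (`0 ≤ {θ/x} < 1`). -/
theorem norm_alcantaraBodeOp_le {f : ℝ → ℂ} (hf : IntegrableOn f (Ioo (0 : ℝ) 1)) (θ : ℝ) :
    ‖alcantaraBodeOp f θ‖ ≤ ∫ x in Ioo (0 : ℝ) 1, ‖f x‖ := by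
  unfold alcantaraBodeOp
  refine (norm_integral_le_integral_norm _).trans
    (integral_mono_of_nonneg (ae_of_all _ fun x => norm_nonneg _) hf.norm
      (ae_of_all _ fun x => ?_))
  dsimp only
  rw [norm_mul, Complex.norm_real, Real.norm_eq_abs, abs_of_nonneg (Int.fract_nonneg _)]
  exact mul_le_of_le_one_right (norm_nonneg _) (Int.fract_lt_one _).le

/-- `∫₀¹ ‖𝟙_(0,h)‖ = h` for `0 ≤ h ≤ 1`. -/
theorem integral_norm_indicator_Ioo {h : ℝ} (h0 : 0 ≤ h) (h1 : h ≤ 1) :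
    ∫ x in Ioo (0 : ℝ) 1, ‖(Ioo (0 : ℝ) h).indicator (fun _ : ℝ => (1 : ℂ)) x‖ = h := by
  have heq : (fun x : ℝ => ‖(Ioo (0 : ℝ) h).indicator (fun _ : ℝ => (1 : ℂ)) x‖) =
      (Ioo (0 : ℝ) h).indicator (fun _ : ℝ => (1 : ℝ)) := by
    funext x
    by_cases hx : x ∈ Ioo (0 : ℝ) h
    · simp [indicator_of_mem hx]
    · simp [indicator_of_notMem hx]
  rw [heq, integral_indicator_const _ measurableSet_Ioo, measureReal_restrict_apply measurableSet_Ioo,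
    inter_eq_left.2 (Ioo_subset_Ioo_right h1), Real.volume_real_Ioo, sub_zero, max_eq_left h0,
    smul_eq_mul, mul_one]

/-- `𝟙_(0,h) ∈ L²(0,1)`. -/
theorem memLp_indicator_Ioo_two (h : ℝ) :
    MemLp ((Ioo (0 : ℝ) h).indicator fun _ : ℝ => (1 : ℂ)) 2 (volume.restrict (Ioo (0 : ℝ) 1)) :=
  (memLp_const (1 : ℂ)).indicator measurableSet_Ioo

/-- `‖A 𝟙_(0,h)‖_{L²(0,1)} ≤ h` for `0 ≤ h ≤ 1` (pointwise `‖(A 𝟙_(0,h))(θ)‖ ≤ ‖𝟙_(0,h)‖₁ = h` on a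
probability space). -/
theorem eLpNorm_alcantaraBodeOp_indicator_le {h : ℝ} (h0 : 0 ≤ h) (h1 : h ≤ 1) :
    eLpNorm (alcantaraBodeOp ((Ioo (0 : ℝ) h).indicator fun _ : ℝ => (1 : ℂ))) 2
      (volume.restrict (Ioo (0 : ℝ) 1)) ≤ ENNReal.ofReal h := by
  have hint : IntegrableOn ((Ioo (0 : ℝ) h).indicator fun _ : ℝ => (1 : ℂ)) (Ioo (0 : ℝ) 1) :=
    (memLp_indicator_Ioo_two h).integrable one_le_two
  have hb : ∀ θ : ℝ, ‖alcantaraBodeOp ((Ioo (0 : ℝ) h).indicator fun _ : ℝ => (1 : ℂ)) θ‖ ≤ h :=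
    fun θ => (norm_alcantaraBodeOp_le hint θ).trans (integral_norm_indicator_Ioo h0 h1).le
  refine (eLpNorm_le_of_ae_bound (ae_of_all _ fun θ => hb θ)).trans ?_
  rw [Measure.restrict_apply_univ, Real.volume_Ioo]
  simp

/-- `‖𝟙_(0,h)‖_{L²(0,1)} = √h` for `0 ≤ h ≤ 1`, in the form `eLpNorm = (ofReal h)^{1/2}`. -/
theorem eLpNorm_indicator_Ioo {h : ℝ} (h1 : h ≤ 1) :
    eLpNorm ((Ioo (0 : ℝ) h).indicator fun _ : ℝ => (1 : ℂ)) 2 (volume.restrict (Ioo (0 : ℝ) 1)) =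
      ENNReal.ofReal h ^ (1 / (2 : ℝ)) := by
  rw [eLpNorm_indicator_const measurableSet_Ioo two_ne_zero ENNReal.ofNat_ne_top,
    Measure.restrict_apply measurableSet_Ioo, inter_eq_left.2 (Ioo_subset_Ioo_right h1),
    Real.volume_Ioo, sub_zero]
  simp

/-- **`A` is not bounded below on `L²(0,1)`** (RH-free, zero-free): there is no `c > 0` with
`c‖f‖₂ ≤ ‖Af‖₂` for all `f ∈ L²(0,1)`; the witnesses `𝟙_(0,h)` (`‖A𝟙_(0,h)‖₂ ≤ h = √h‖𝟙_(0,h)‖₂`)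
lie in every space of step functions of mesh `h`, so no "injectivity parameter" of finite sections
is bounded below uniformly in the mesh.  Every coercive / effective-injectivity conjunct of a
section splitting of Alcántara-Bode's criterion is therefore false. -/
theorem alcantaraBodeOp_not_coercive :
    ¬ ∃ c : ℝ, 0 < c ∧ ∀ f : ℝ → ℂ, MemLp f 2 (volume.restrict (Ioo (0 : ℝ) 1)) →
      ENNReal.ofReal c * eLpNorm f 2 (volume.restrict (Ioo (0 : ℝ) 1)) ≤
        eLpNorm (alcantaraBodeOp f) 2 (volume.restrict (Ioo (0 : ℝ) 1)) := by
  rintro ⟨c, hc, hA⟩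
  set d : ℝ := min (1 / 2) (c / 2) with hd
  have hd0 : 0 < d := lt_min (by norm_num) (by linarith)
  have hd1 : d ≤ 1 / 2 := min_le_left _ _
  have hdc : d < c := (min_le_right _ _).trans_lt (by linarith)
  have hh0 : 0 ≤ d ^ 2 := sq_nonneg d
  have hh1 : d ^ 2 ≤ 1 := by nlinarith
  have key := (hA _ (memLp_indicator_Ioo_two (d ^ 2))).trans
    (eLpNorm_alcantaraBodeOp_indicator_le hh0 hh1)
  rw [eLpNorm_indicator_Ioo hh1, ENNReal.ofReal_rpow_of_nonneg hh0 (by norm_num),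
    ← Real.sqrt_eq_rpow, Real.sqrt_sq hd0.le, ← ENNReal.ofReal_mul hc.le,
    ENNReal.ofReal_le_ofReal_iff hh0] at key
  nlinarith

/-! ## §2  Kernel pairs attached to the zeros of `ζ` in `Re s > 1/2` -/

/-- A zero of `ζ` has `Re s < 1` (Mathlib: no zeros on `Re s ≥ 1`). (`private`: the statement restates the landed
`Literature.NumberTheory.DiophantineGeometry.re_lt_one_of_riemannZeta_eq_zero` of `NamedHypothesesProofs.lean` — gate
`dedup.landed`, typer-applied one-word repair, filing of lane (xv-S); proof bytes unchanged.) -/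
private theorem re_lt_one_of_zeta_eq_zero {s : ℂ} (h : riemannZeta s = 0) : s.re < 1 := by
  by_contra h1
  exact riemannZeta_ne_zero_of_one_le_re (not_lt.1 h1) h

/-- A zero of `ζ` with `Re s > 0` is not real (the tree's `riemannZeta_ofReal_ne_zero_of_pos_of_lt_one`). -/
theorem im_ne_zero_of_zeta_eq_zero {s : ℂ} (h : riemannZeta s = 0) (hs : 0 < s.re) : s.im ≠ 0 := by
  intro h0
  have h1 := re_lt_one_of_zeta_eq_zero h
  have hs' : s = ((s.re : ℝ) : ℂ) := Complex.ext (by simp) (by simp [h0])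
  rw [hs'] at h
  exact riemannZeta_ofReal_ne_zero_of_pos_of_lt_one s.re hs h1 h

/-- `s ≠ s̄` for a zero of `ζ` with `Re s > 0`. -/
theorem sub_conj_ne_zero_of_zeta_eq_zero {s : ℂ} (h : riemannZeta s = 0) (hs : 0 < s.re) :
    s - (starRingEnd ℂ) s ≠ 0 := by
  intro h0
  have : (s - (starRingEnd ℂ) s).im = 0 := by rw [h0]; simp
  have h2 : (s - (starRingEnd ℂ) s).im = 2 * s.im := by simp; ring
  exact im_ne_zero_of_zeta_eq_zero h hs (by linarith)

/-- `s + k ≠ 0` and `s̄ + k ≠ 0` for `Re s > 0`, `k : ℕ`. -/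
theorem add_natCast_ne_zero_of_re_pos {s : ℂ} (hs : 0 < s.re) (k : ℕ) :
    s + k ≠ 0 ∧ (starRingEnd ℂ) s + k ≠ 0 := by
  constructor
  · intro h0
    have : (s + k).re = 0 := by rw [h0]; simp
    simp at this
    have hk : (0 : ℝ) ≤ k := k.cast_nonneg
    linarith
  · intro h0
    have : ((starRingEnd ℂ) s + k).re = 0 := by rw [h0]; simp
    simp at this
    have hk : (0 : ℝ) ≤ k := k.cast_nonneg
    linarith

/-- Moments of `x^{s-1}`: `∫₀¹ x^{s-1} x^k dx = 1/(s+k)` (`Re s > 0`, `k : ℕ`). -/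
theorem integral_cpow_mul_pow_Ioo {s : ℂ} (hs : 0 < s.re) (k : ℕ) :
    ∫ x in Ioo (0 : ℝ) 1, (x : ℂ) ^ (s - 1) * (x : ℂ) ^ k = 1 / (s + k) := by
  have hk : 0 < (s + k).re := by
    simp only [add_re, natCast_re]
    have : (0 : ℝ) ≤ k := k.cast_nonneg
    linarith
  rw [← integral_cpow_Ioo_zero_one hk]
  refine setIntegral_congr_fun measurableSet_Ioo fun x hx => ?_
  have hx0 : (x : ℂ) ≠ 0 := by exact_mod_cast hx.1.ne'
  rw [show s + k - 1 = (s - 1) + k by ring, cpow_add _ _ hx0, cpow_natCast]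

/-- `x^{s-1}` is integrable on `(0,1)` for `Re s > 0` (the tree's `memLp_cpow_Ioo_of_lt` at `q = 1`). -/
theorem integrableOn_cpow_Ioo {s : ℂ} (hs : 0 < s.re) :
    IntegrableOn (fun x : ℝ => (x : ℂ) ^ (s - 1)) (Ioo (0 : ℝ) 1) := by
  have h := memLp_cpow_Ioo_of_lt (s := s) (q := 1) one_pos (by norm_num; exact hs)
  rw [ENNReal.ofReal_one, memLp_one_iff_integrable] at h
  exact h

/-- `x^{s-1} x^k` is integrable on `(0,1)` for `Re s > 0`. -/
theorem integrableOn_cpow_mul_pow {s : ℂ} (hσ : 0 < s.re) (k : ℕ) :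
    IntegrableOn (fun x : ℝ => (x : ℂ) ^ (s - 1) * (x : ℂ) ^ k) (Ioo (0 : ℝ) 1) := by
  have hσk : 0 < (s + k).re := by
    simp only [add_re, natCast_re]
    have : (0 : ℝ) ≤ k := k.cast_nonneg
    linarith
  have hI : IntegrableOn (fun x : ℝ => (x : ℂ) ^ (s + k - 1)) (Ioo (0 : ℝ) 1) :=
    integrableOn_cpow_Ioo hσk
  refine hI.congr_fun (fun x hx => ?_) measurableSet_Ioo
  have hx0 : (x : ℂ) ≠ 0 := by exact_mod_cast hx.1.ne'
  simp only
  rw [show s + k - 1 = (s - 1) + k by ring, cpow_add _ _ hx0, cpow_natCast]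

/-- The kernel pair `m_s` is in `L²(0,1)` (`Re s > 1/2`). -/
theorem memLp_kernelPair {s : ℂ} (hσ : 1 / 2 < s.re) {m : ℝ → ℂ}
    (hm : ∀ x : ℝ, m x = (s - 1) * (x : ℂ) ^ (s - 1) -
      ((starRingEnd ℂ) s - 1) * (x : ℂ) ^ ((starRingEnd ℂ) s - 1)) :
    MemLp m 2 (volume.restrict (Ioo (0 : ℝ) 1)) := by
  have hσ' : 1 / 2 < ((starRingEnd ℂ) s).re := by simpa using hσ
  rw [show m = fun x : ℝ => (s - 1) * (x : ℂ) ^ (s - 1) -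
      ((starRingEnd ℂ) s - 1) * (x : ℂ) ^ ((starRingEnd ℂ) s - 1) from funext hm]
  exact ((memLp_two_cpow_Ioo hσ).const_mul _).sub ((memLp_two_cpow_Ioo hσ').const_mul _)

/-- A linear combination `a g₁ - b g₂` of integrable functions passes through `A`. -/
theorem alcantaraBodeOp_lincomb {g₁ g₂ f : ℝ → ℂ} {a b : ℂ}
    (h₁ : IntegrableOn g₁ (Ioo (0 : ℝ) 1)) (h₂ : IntegrableOn g₂ (Ioo (0 : ℝ) 1))
    (hf : ∀ x : ℝ, f x = a * g₁ x - b * g₂ x) (θ : ℝ) :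
    alcantaraBodeOp f θ = a * alcantaraBodeOp g₁ θ - b * alcantaraBodeOp g₂ θ := by
  have hb : ∀ x : ℝ, ‖((Int.fract (θ / x) : ℝ) : ℂ)‖ ≤ 1 := fun x => by
    rw [Complex.norm_real, Real.norm_eq_abs, abs_of_nonneg (Int.fract_nonneg _)]
    exact (Int.fract_lt_one _).le
  have hmeasF : AEStronglyMeasurable (fun x : ℝ => ((Int.fract (θ / x) : ℝ) : ℂ))
      (volume.restrict (Ioo (0 : ℝ) 1)) :=
    (Complex.measurable_ofReal.comp (measurable_fract.comp
      (measurable_const.div measurable_id))).aestronglyMeasurable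
  have hI1 : IntegrableOn (fun x : ℝ => g₁ x * ((Int.fract (θ / x) : ℝ) : ℂ)) (Ioo (0 : ℝ) 1) :=
    h₁.mul_bdd hmeasF (ae_of_all _ hb)
  have hI2 : IntegrableOn (fun x : ℝ => g₂ x * ((Int.fract (θ / x) : ℝ) : ℂ)) (Ioo (0 : ℝ) 1) :=
    h₂.mul_bdd hmeasF (ae_of_all _ hb)
  unfold alcantaraBodeOp
  have hsplit : (fun x : ℝ => f x * ((Int.fract (θ / x) : ℝ) : ℂ)) = fun x : ℝ =>
      a * (g₁ x * ((Int.fract (θ / x) : ℝ) : ℂ)) - b * (g₂ x * ((Int.fract (θ / x) : ℝ) : ℂ)) := by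
    funext x; rw [hf]; ring
  rw [hsplit, integral_sub (hI1.const_mul _) (hI2.const_mul _), integral_const_mul,
    integral_const_mul]

/-- **Kernel pairs.**  For a zero `s` of `ζ` with `Re s > 1/2`, the function
`m_s(x) = (s-1)x^{s-1} - (s̄-1)x^{s̄-1}` satisfies `(A m_s)(θ) = 0` for every `θ ∈ (0,1)`
(Beurling's identity `A x^{s-1} = θ/(s-1) - θ^s ζ(s)/s`, the tree's `alcantaraBodeOp_cpow`, at `s`
and `s̄`). -/
theorem alcantaraBodeOp_kernelPair {s : ℂ} (hζ : riemannZeta s = 0) (hre : 0 < s.re)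
    {m : ℝ → ℂ} (hm : ∀ x : ℝ, m x = (s - 1) * (x : ℂ) ^ (s - 1) -
      ((starRingEnd ℂ) s - 1) * (x : ℂ) ^ ((starRingEnd ℂ) s - 1))
    {θ : ℝ} (hθ : θ ∈ Ioo (0 : ℝ) 1) : alcantaraBodeOp m θ = 0 := by
  have hs1 : s ≠ 1 := fun h1 => by
    have := re_lt_one_of_zeta_eq_zero hζ; rw [h1] at this; simp at this
  set s' : ℂ := (starRingEnd ℂ) s with hs'def
  have hζ' : riemannZeta s' = 0 := by rw [hs'def, riemannZeta_conj, hζ, map_zero]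
  have hre' : 0 < s'.re := by simpa [hs'def] using hre
  have hs'1 : s' ≠ 1 := by
    intro h1
    have : s'.im = 0 := by rw [h1]; simp
    simp [hs'def] at this
    exact im_ne_zero_of_zeta_eq_zero hζ hre this
  have hi1 : IntegrableOn (fun x : ℝ => (x : ℂ) ^ (s - 1)) (Ioo (0 : ℝ) 1) :=
    integrableOn_cpow_Ioo hre
  have hi2 : IntegrableOn (fun x : ℝ => (x : ℂ) ^ (s' - 1)) (Ioo (0 : ℝ) 1) :=
    integrableOn_cpow_Ioo hre'
  rw [alcantaraBodeOp_lincomb hi1 hi2 hm θ, alcantaraBodeOp_cpow hθ.1 hθ.2.le hre hs1,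
    alcantaraBodeOp_cpow hθ.1 hθ.2.le hre' hs'1, hζ, hζ']
  have hs0 : s ≠ 0 := fun h0 => by simp [h0] at hre
  have hs'0 : s' ≠ 0 := fun h0 => by simp [h0] at hre'
  field_simp
  ring

/-- Almost-everywhere form of `alcantaraBodeOp_kernelPair` on `(0,1)`. -/
theorem alcantaraBodeOp_kernelPair_ae {s : ℂ} (hζ : riemannZeta s = 0) (hσ : 0 < s.re)
    {m : ℝ → ℂ} (hm : ∀ x : ℝ, m x = (s - 1) * (x : ℂ) ^ (s - 1) -
      ((starRingEnd ℂ) s - 1) * (x : ℂ) ^ ((starRingEnd ℂ) s - 1)) :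
    ∀ᵐ θ ∂(volume.restrict (Ioo (0 : ℝ) 1)), alcantaraBodeOp m θ = 0 := by
  filter_upwards [ae_restrict_mem measurableSet_Ioo] with θ hθ
  exact alcantaraBodeOp_kernelPair hζ hσ hm hθ

/-- **Moments of a kernel pair.**  `∫₀¹ m_s(x) x^k dx = (s-1)/(s+k) - (s̄-1)/(s̄+k)` (`k : ℕ`). -/
theorem integral_kernelPair_mul_pow {s : ℂ} (hre : 0 < s.re) {m : ℝ → ℂ}
    (hm : ∀ x : ℝ, m x = (s - 1) * (x : ℂ) ^ (s - 1) -
      ((starRingEnd ℂ) s - 1) * (x : ℂ) ^ ((starRingEnd ℂ) s - 1)) (k : ℕ) :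
    ∫ x in Ioo (0 : ℝ) 1, m x * (x : ℂ) ^ k =
      (s - 1) / (s + k) - ((starRingEnd ℂ) s - 1) / ((starRingEnd ℂ) s + k) := by
  have hre' : 0 < ((starRingEnd ℂ) s).re := by simpa using hre
  have hsplit : (fun x : ℝ => m x * (x : ℂ) ^ k) = fun x : ℝ =>
      (s - 1) * ((x : ℂ) ^ (s - 1) * (x : ℂ) ^ k) -
        ((starRingEnd ℂ) s - 1) * ((x : ℂ) ^ ((starRingEnd ℂ) s - 1) * (x : ℂ) ^ k) := by
    funext x; rw [hm]; ring
  rw [hsplit, integral_sub ((integrableOn_cpow_mul_pow hre k).const_mul _)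
      ((integrableOn_cpow_mul_pow hre' k).const_mul _),
    integral_const_mul, integral_const_mul, integral_cpow_mul_pow_Ioo hre, integral_cpow_mul_pow_Ioo hre']
  ring

/-- Closed form of the moments: `(s-1)/(s+k) - (u-1)/(u+k) = (k+1)(s-u)/((s+k)(u+k))`. -/
theorem kernelPair_moment_eq {s u : ℂ} (k : ℕ) (hs : s + k ≠ 0) (hu : u + k ≠ 0) :
    (s - 1) / (s + k) - (u - 1) / (u + k) = (k + 1) * (s - u) / ((s + k) * (u + k)) := by
  field_simp
  ring

/-- `x^k m_s(x)`-type products with an `L²` weight are integrable: `m w ∈ L¹` for `m, w ∈ L²`. -/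
theorem integrable_mul_of_memLp_two_Ioo {m w : ℝ → ℂ}
    (hm : MemLp m 2 (volume.restrict (Ioo (0 : ℝ) 1)))
    (hw : MemLp w 2 (volume.restrict (Ioo (0 : ℝ) 1))) :
    Integrable (fun x : ℝ => m x * w x) (volume.restrict (Ioo (0 : ℝ) 1)) :=
  hm.integrable_mul hw

/-- A kernel pair is not a.e. zero: its `0`-th moment is `(s - s̄)/(s s̄) ≠ 0`. -/
theorem kernelPair_not_ae_zero {s : ℂ} (hζ : riemannZeta s = 0) (hre : 0 < s.re) {m : ℝ → ℂ}
    (hm : ∀ x : ℝ, m x = (s - 1) * (x : ℂ) ^ (s - 1) -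
      ((starRingEnd ℂ) s - 1) * (x : ℂ) ^ ((starRingEnd ℂ) s - 1)) :
    ¬ m =ᵐ[volume.restrict (Ioo (0 : ℝ) 1)] 0 := by
  intro hm0
  have hint0 : ∫ x in Ioo (0 : ℝ) 1, m x * (x : ℂ) ^ (0 : ℕ) = 0 := by
    rw [integral_congr_ae (g := 0) (by filter_upwards [hm0] with x hx; simp [hx])]
    simp
  obtain ⟨hs0, hu0⟩ := add_natCast_ne_zero_of_re_pos hre 0
  rw [integral_kernelPair_mul_pow hre hm 0, kernelPair_moment_eq 0 hs0 hu0, div_eq_zero_iff,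
    mul_eq_zero, mul_eq_zero] at hint0
  rcases hint0 with (h | h) | (h | h)
  · norm_num at h
  · exact sub_conj_ne_zero_of_zeta_eq_zero hζ hre h
  · exact hs0 h
  · exact hu0 h

/-- The kernel pair of `s` lies in `L^q(0,1)` whenever `Re s > 1 - 1/q` (tree: `memLp_cpow_Ioo_of_lt`). -/
theorem memLp_kernelPair_of_lt {s : ℂ} {q : ℝ} (hq : 0 < q) (hσ : 1 - 1 / q < s.re) {m : ℝ → ℂ}
    (hm : ∀ x : ℝ, m x = (s - 1) * (x : ℂ) ^ (s - 1) -
      ((starRingEnd ℂ) s - 1) * (x : ℂ) ^ ((starRingEnd ℂ) s - 1)) :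
    MemLp m (ENNReal.ofReal q) (volume.restrict (Ioo (0 : ℝ) 1)) := by
  have hσ' : 1 - 1 / q < ((starRingEnd ℂ) s).re := by simpa using hσ
  rw [show m = fun x : ℝ => (s - 1) * (x : ℂ) ^ (s - 1) -
      ((starRingEnd ℂ) s - 1) * (x : ℂ) ^ ((starRingEnd ℂ) s - 1) from funext hm]
  exact ((memLp_cpow_Ioo_of_lt hq hσ).const_mul _).sub ((memLp_cpow_Ioo_of_lt hq hσ').const_mul _)

/-! ## §2b  EXPONENT axis: `A` is not injective on `L^q(0,1)` for `q < 2` — unconditionally (Hardy) -/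

/-- **Not injective below the exponent 2 (RH-free, via Hardy 1914).**  For every `0 < q < 2` there is
`f ∈ L^q(0,1)`, `f ≠ 0`, with `(Af)(θ) = 0` for every `θ ∈ (0,1)`: the kernel pair of a zero
`1/2 + it` on the critical line (tree: `hardy_infinite_zeros_on_critical_line_holds`), which is in
`L^q(0,1)` exactly for `q < 2`.  So an injectivity conjunct for the `L^q`-extension of `A`, `q < 2`,
is FALSE; at `q = 2` it is RH (`AlcantaraBode1993_criterion_holds`). -/
theorem alcantaraBodeOp_not_injective_Lq {q : ℝ} (hq0 : 0 < q) (hq2 : q < 2) :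
    ∃ f : ℝ → ℂ, MemLp f (ENNReal.ofReal q) (volume.restrict (Ioo (0 : ℝ) 1)) ∧
      ¬ f =ᵐ[volume.restrict (Ioo (0 : ℝ) 1)] 0 ∧ ∀ θ ∈ Ioo (0 : ℝ) 1, alcantaraBodeOp f θ = 0 := by
  obtain ⟨t, ht⟩ := (hardy_infinite_zeros_on_critical_line_holds).nonempty
  have hζ : riemannZeta (1 / 2 + t * I) = 0 := ht
  have hre : 0 < (1 / 2 + t * I : ℂ).re := by simp
  have hσ : 1 - 1 / q < (1 / 2 + t * I : ℂ).re := by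
    have hq' : 1 / 2 < 1 / q := by
      rw [div_lt_div_iff₀ (by norm_num) hq0]; linarith
    simp only [add_re, one_div, inv_re, mul_re, ofReal_re, I_re, mul_zero, ofReal_im, I_im,
      mul_one, sub_self, add_zero]
    norm_num at hq' ⊢
    linarith
  refine ⟨fun x : ℝ => ((1 / 2 + t * I : ℂ) - 1) * (x : ℂ) ^ ((1 / 2 + t * I : ℂ) - 1) -
      ((starRingEnd ℂ) (1 / 2 + t * I) - 1) * (x : ℂ) ^ ((starRingEnd ℂ) (1 / 2 + t * I) - 1),
    memLp_kernelPair_of_lt hq0 hσ (fun _ => rfl), kernelPair_not_ae_zero hζ hre (fun _ => rfl),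
    fun θ hθ => alcantaraBodeOp_kernelPair hζ hre (fun _ => rfl) hθ⟩

end Summit.RiemannHypothesis.RiemannHypothesis.Theorems.Splittings.NbOperator
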